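import Literature.Geometry.Riemannian.HeatGradientInteriorEstimate
import Literature.Geometry.Riemannian.HeatKernelExponentialMoment
import Literature.Geometry.Riemannian.RicciFlowHeatKernelFn
import Literature.Geometry.Riemannian.NashEntropy
import HarnessLib

/-!
# The gradient step of Bamler's heat kernel bootstrap (Bamler 2020a, §7.2, proof of Thm. 7.1,
# displays (7.6)–(7.8))

R. Bamler, *Entropy and heat kernel bounds on a Ricci flow background*, arXiv:2008.07093 (2020a),
§7.2, proof of the heat kernel upper bound Thm. 7.1. After parabolic rescaling to `s = 0`,
`t = 1`, the proof bootstraps a bound `K(·, ½; y, 0) ≤ Z (½)^{-n/2} exp(−𝒩*_0(·, ½))` on the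
time-`½` slice of `u := K(·, ·; y, 0)` to a gradient bound at the later times `t ∈ [¾, 1]`:

* (7.6) the interior gradient estimate `(t − ½)|∇u|²(x, t) ≤ ∫ K(x, t; ·, ½) u²(·, ½) dg_{½}`
  ((7.4)–(7.5));
* (7.7) the pointwise bound `u²(y', ½) ≤ Z² 2ⁿ exp(−2𝒩*_0(y', ½))` together with the entropy
  comparison near an `H_n`-centre `(z, ½)` of `(x, t)`,
  `−𝒩*_0(y', ½) ≤ −𝒩*_0(x, t) + C + C d_{½}(z, y')`;
* (7.8) the exponential moment bound `∫ exp(κ d_{½}(z, ·)) dν_{x,t;½} ≤ C(κ)`, giving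
  `|∇u|²(x, t) ≤ C Z² exp(−2𝒩*_0(x, t))`.

This file proves this step, `gradSq_heatKernelFn_le_of_forall_le`, un-rescaled and with explicit
constants, for a Ricci flow `hflow = (h, cov)` on `[a, T]` of a `C^∞` family of Riemannian metrics
on a closed connected manifold `M` modelled on `ℝᵐ` (`m ≥ 1`): with `s₂ = s + τ/2`,
`H = (m − 1)π²/2 + 4`, `u(r, w) = K(w, r; y, s)` (`IsRicciFlow.heatKernelFn`),
`𝒩*_s(w, r)` the pointed Nash entropy of `K(w, r; ·, ·)` (`pointedNashEntropy`), the hypotheses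
(HZ) `u(s₂, ·) ≤ Z (τ/2)^{-m/2} exp(−𝒩*_s(·, s₂))` and (HEC) "every `(x', t')`,
`t' ∈ [s + 3τ/4, s + τ]`, has a point `z` with `∫ d_{s₂}(z, ·)² dν_{x',t';s₂} ≤ H (t' − s₂)` and
`𝒩*_s(x', t') − 𝒩*_s(w, s₂) ≤ c + L d_{s₂}(z, w)` for all `w`" give

  `|∇u(t')|²_{h(t')}(x') ≤ 2^{m+2} · 3 · exp(2c + 16 L² τ + 2L √(H τ)) Z² τ^{-(m+1)}
    exp(−2 𝒩*_s(x', t'))`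

for all `x'` and `t' ∈ [s + 3τ/4, s + τ]` (`s + τ < T`). Ingredients: the interior gradient
estimate `mul_gradSq_add_sq_le_integral_sq_heatKernelMeasure`
(`HeatGradientInteriorEstimate.lean`), applied to `u` on `M × [s₂, t']` (smooth and caloric in the
base point by `IsRicciFlow.contMDiffOn_heatKernelFn_basePoint`,
`IsRicciFlow.deriv_heatKernelFn_basePoint`), and the exponential moment bound
`integral_exp_mul_edist_heatKernelMeasure_le` (`HeatKernelExponentialMoment.lean`).

Everything is proved; no definitions, no named facts. What is NOT here: the hypotheses (HZ),
(HEC) themselves (the inductive bound, the existence of `H_n`-centres Prop. 3.13 and the entropy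
comparison Thm. 5.9 / Cor. 5.10), the ball and tail parts (7.9)–(7.12) of the bootstrap, and the
conclusion of Thm. 7.1.

## References

* R. H. Bamler, *Entropy and heat kernel bounds on a Ricci flow background*, arXiv:2008.07093
  (2020), §7.2, proof of Thm. 7.1, displays (7.6)–(7.8). [Bamler2020Entropy]
-/

noncomputable section

open Bundle Set Function Filter Manifold MeasureTheory Measure TopologicalSpace
open scoped Manifold ContDiff Topology ENNReal NNReal

namespace Literature.Geometry.Riemannian

open Lorentzian Lorentzian.PseudoRiemannianMetric

section BootstrapGradient

/-- **The gradient step of Bamler's heat kernel bootstrap** (Bamler 2020a, §7.2, proof of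
Thm. 7.1, (7.6)–(7.8)). Let `(h, cov)` be a Ricci flow on `[a, T]` of a smooth family of
Riemannian metrics on a closed connected manifold `M` modelled on `ℝᵐ`, `m ≥ 1`, `a < s`,
`0 < τ`, `s + τ < T`, `y ∈ M`, `s₂ = s + τ/2`, `H = (m − 1)π²/2 + 4`, `u(r, w) = K(w, r; y, s)` and
`𝒩*_s(w, r)` the pointed Nash entropy of `K(w, r; ·, ·)` based at `s`. Assume
(HZ) `u(s₂, z) ≤ Z (τ/2)^{-m/2} exp(−𝒩*_s(z, s₂))` for all `z`, and (HEC) for all `x'` and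
`t' ∈ [s + 3τ/4, s + τ]` there is `z` with `∫ d_{s₂}(z, ·)² dν_{x',t';s₂} ≤ H (t' − s₂)` and
`𝒩*_s(x', t') − 𝒩*_s(w, s₂) ≤ c + L d_{s₂}(z, w)` for all `w` (`Z, L, c ≥ 0`; the sign of `c`
is not used). Then for all `x'` and `t' ∈ [s + 3τ/4, s + τ]`

  `|∇u(t')|²(x') ≤ 2^{m+2} · 3 · e^{2c + 16L²τ + 2L√(Hτ)} Z² τ^{-(m+1)} e^{−2𝒩*_s(x', t')}`.

Proof: by the interior gradient estimate on `[s₂, t']`,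
`(t' − s₂)|∇u(t')|²(x') ≤ ∫ u(s₂, ·)² dν`, `ν = ν_{x',t';s₂}`; pointwise
`u(s₂, w)² ≤ Z² (τ/2)^{-m} e^{2c − 2𝒩*_s(x',t')} e^{2L d_{s₂}(z, w)}` by (HZ), (HEC); the
exponential moment bound gives `∫ e^{2L d_{s₂}(z, ·)} dν ≤ 3 e^{32L²(t' − s₂) + 2L√(2H(t' − s₂))}`
`≤ 3 e^{16L²τ + 2L√(Hτ)}` (`t' − s₂ ≤ τ/2`); divide by `t' − s₂ ≥ τ/4`.
[cite: Bamler2020Entropy, §7.2, proof of Thm. 7.1, (7.6)–(7.8)] -/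
theorem gradSq_heatKernelFn_le_of_forall_le {m : ℕ} {H : Type*} [TopologicalSpace H]
    {I : ModelWithCorners ℝ (EuclideanSpace ℝ (Fin m)) H} [I.Boundaryless]
    {M : Type*} [TopologicalSpace M] [ChartedSpace H M] [IsManifold I ∞ M]
    [T2Space M] [CompactSpace M] [SecondCountableTopology M] [MeasurableSpace M] [BorelSpace M]
    [ConnectedSpace M]
    {h : ℝ → PseudoRiemannianMetric I ∞ (EuclideanSpace ℝ (Fin m)) (TangentSpace I : M → Type _)}
    {cov : ℝ → CovariantDerivative I (EuclideanSpace ℝ (Fin m)) (TangentSpace I : M → Type _)}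
    {a T : ℝ} (hflow : IsRicciFlow h cov (Icc a T)) (hh : IsContMDiffFamilyOn ∞ h univ)
    (hR : ∀ r, (h r).IsRiemannian) (hm : 0 < m) {s τ : ℝ} (has : a < s) (hτ : 0 < τ)
    (hτT : s + τ < T) (y : M) {Z L c : ℝ} (hZ : 0 ≤ Z) (hL : 0 ≤ L) (_hc : 0 ≤ c)
    (HZ : ∀ z : M, hflow.heatKernelFn hh hR (s + τ / 2) z (y, s) ≤
      Z * (τ / 2) ^ (-(m : ℝ) / 2) * Real.exp (-(pointedNashEntropy h
        (fun r w ↦ hflow.heatKernelFn hh hR (s + τ / 2) z (w, r)) m (s + τ / 2) s)))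
    (HEC : ∀ x' : M, ∀ t' ∈ Icc (s + 3 * τ / 4) (s + τ), ∃ z : M,
      ∫⁻ w, (h (s + τ / 2)).edist (hR (s + τ / 2)) z w ^ 2
          ∂(heatKernelMeasure hh hR t' x' (s + τ / 2)) ≤
        ENNReal.ofReal ((((m : ℝ) - 1) * Real.pi ^ 2 / 2 + 4) * (t' - (s + τ / 2))) ∧
      ∀ w : M, pointedNashEntropy h (fun r v ↦ hflow.heatKernelFn hh hR t' x' (v, r)) m t' s -
          pointedNashEntropy h (fun r v ↦ hflow.heatKernelFn hh hR (s + τ / 2) w (v, r)) m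
            (s + τ / 2) s ≤
        c + L * ((h (s + τ / 2)).edist (hR (s + τ / 2)) z w).toReal)
    (x' : M) (t' : ℝ) (ht' : t' ∈ Icc (s + 3 * τ / 4) (s + τ)) :
    (h t').gradSq (fun z ↦ hflow.heatKernelFn hh hR t' z (y, s)) x' ≤
      2 ^ (m + 2) * 3 * Real.exp (2 * c + 16 * L ^ 2 * τ +
          2 * L * Real.sqrt ((((m : ℝ) - 1) * Real.pi ^ 2 / 2 + 4) * τ)) *
        Z ^ 2 * τ ^ (-((m : ℝ) + 1)) * Real.exp (-2 * pointedNashEntropy h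
          (fun r w ↦ hflow.heatKernelFn hh hR t' x' (w, r)) m t' s) := by
  obtain ⟨z, hz, hEC⟩ := HEC x' t' ht'
  -- times: `a < s < s₂ = s + τ/2 < t' ≤ s + τ < T`
  have hs₂ : s < s + τ / 2 := by linarith
  have has₂ : a < s + τ / 2 := has.trans hs₂
  have hs₂t : s + τ / 2 < t' := by linarith [ht'.1]
  have ht'T' : t' < T := ht'.2.trans_lt hτT
  have ht'T : t' ≤ T := ht'T'.le
  have hδ : τ / 4 ≤ t' - (s + τ / 2) := by linarith [ht'.1]
  have hδ' : t' - (s + τ / 2) ≤ τ / 2 := by linarith [ht'.2]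
  have hsT : s ∈ Ioo a T := ⟨has, hs₂.trans (hs₂t.trans ht'T')⟩
  -- abbreviations
  set Hm : ℝ := ((m : ℝ) - 1) * Real.pi ^ 2 / 2 + 4 with hHm
  set Nt : ℝ := pointedNashEntropy h (fun r w ↦ hflow.heatKernelFn hh hR t' x' (w, r)) m t' s
    with hNt
  set P : ℝ := (τ / 2) ^ (-(m : ℝ) / 2) with hP
  set d : M → ℝ := fun w ↦ ((h (s + τ / 2)).edist (hR (s + τ / 2)) z w).toReal with hd
  set ν : Measure M := heatKernelMeasure hh hR t' x' (s + τ / 2) with hν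
  set u : ℝ → M → ℝ := fun r w ↦ hflow.heatKernelFn hh hR r w (y, s) with hu
  have hHm0 : 0 < Hm := by
    have hm1 : (1 : ℝ) ≤ m := by exact_mod_cast hm
    have : 0 ≤ ((m : ℝ) - 1) * Real.pi ^ 2 / 2 := by
      have := sub_nonneg.2 hm1
      positivity
    rw [hHm]
    linarith
  have hP0 : 0 < P := Real.rpow_pos_of_pos (by positivity) _
  -- (1) the interior gradient estimate for `u = K(·, ·; y, s)` on `M × [s₂, t']`
  have hK : ContMDiffOn (I.prod 𝓘(ℝ, ℝ)) 𝓘(ℝ, ℝ) ∞ (fun p : M × ℝ ↦ u p.2 p.1)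
      (univ ×ˢ Ioo s T) :=
    hflow.contMDiffOn_heatKernelFn_basePoint hh hR hsT y
  have hus : ContMDiffOn (I.prod 𝓘(ℝ, ℝ)) 𝓘(ℝ, ℝ) ∞ (fun p : M × ℝ ↦ u p.2 p.1)
      (univ ×ˢ Icc (s + τ / 2) t') :=
    hK.mono (prod_mono le_rfl (Icc_subset_Ioo hs₂ ht'T'))
  have hueq : ∀ r ∈ Icc (s + τ / 2) t', ∀ w : M,
      HasDerivWithinAt (fun r' ↦ u r' w) ((h r).laplaceBeltrami (u r) w)
        (Icc (s + τ / 2) t') r := by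
    intro r hr w
    have hr' : r ∈ Ioo s T := ⟨hs₂.trans_le hr.1, hr.2.trans_lt ht'T'⟩
    have h1 := hasDerivWithinAt_time_of_contMDiffOn (by simp) hK w hr'
    rw [derivWithin_of_isOpen isOpen_Ioo hr'] at h1
    have h2 := h1.hasDerivAt (isOpen_Ioo.mem_nhds hr')
    have heq := hflow.deriv_heatKernelFn_basePoint hh hR hsT y (p := (w, r)) ⟨mem_univ _, hr'⟩
    dsimp only at heq
    rw [heq] at h2
    exact h2.hasDerivWithinAt
  have key := mul_gradSq_add_sq_le_integral_sq_heatKernelMeasure hflow hh hR has₂ hs₂t ht'T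
    hus hueq x'
  -- `key : (t' − s₂) |∇u(t')|²(x') + u(t', x')² ≤ ∫ u(s₂, w)² dν`
  -- (2) the pointwise bound `u(s₂, w)² ≤ (Z P)² e^{2c − 2 Nt} e^{2L d(w)}`
  have hupos : ∀ w, 0 < u (s + τ / 2) w := fun w ↦
    hflow.heatKernelFn_pos hh hR ⟨has₂, hs₂t.le.trans ht'T⟩ w ⟨mem_univ _, has, hs₂⟩
  have hpt : ∀ w, u (s + τ / 2) w ^ 2 ≤
      (Z * P) ^ 2 * Real.exp (2 * c - 2 * Nt) * Real.exp (2 * L * d w) := by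
    intro w
    have h1 : u (s + τ / 2) w ≤ Z * P * Real.exp (-Nt + c + L * d w) :=
      (HZ w).trans (mul_le_mul_of_nonneg_left (Real.exp_le_exp.2 (by linarith [hEC w]))
        (mul_nonneg hZ hP0.le))
    have h2 : u (s + τ / 2) w ^ 2 ≤ (Z * P * Real.exp (-Nt + c + L * d w)) ^ 2 :=
      pow_le_pow_left₀ (hupos w).le h1 2
    refine h2.trans_eq ?_
    rw [mul_pow, sq (Real.exp _), ← Real.exp_add, mul_assoc ((Z * P) ^ 2), ← Real.exp_add]
    congr 2
    ring
  -- (3) integrate and use the exponential moment bound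
  have hcont : Continuous fun w ↦ (h (s + τ / 2)).edist (hR (s + τ / 2)) z w :=
    ((h (s + τ / 2)).continuous_edist (hR (s + τ / 2))).comp (.prodMk_right z)
  have hdc : Continuous d := continuous_iff_continuousAt.2 fun w ↦
    (ENNReal.tendsto_toReal (PseudoRiemannianMetric.edist_ne_top (hR (s + τ / 2)) z w)).comp
      (hcont.tendsto w)
  have hu₂c : Continuous (u (s + τ / 2)) :=
    (contMDiff_slice_of_contMDiffOn hK ⟨hs₂, hs₂t.trans ht'T'⟩).continuous
  have hint₁ : Integrable (fun w ↦ u (s + τ / 2) w ^ 2) ν :=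
    (hu₂c.pow 2).integrable_of_hasCompactSupport (HasCompactSupport.of_compactSpace _)
  have hint₂ : Integrable
      (fun w ↦ (Z * P) ^ 2 * Real.exp (2 * c - 2 * Nt) * Real.exp (2 * L * d w)) ν :=
    (continuous_const.mul (by fun_prop)).integrable_of_hasCompactSupport
      (HasCompactSupport.of_compactSpace _)
  have hmom := integral_exp_mul_edist_heatKernelMeasure_le hflow hh hR hm has₂ hs₂t ht'T x' z
    hz (mul_nonneg zero_le_two hL)
  -- `hmom : ∫ e^{2L d} dν ≤ 3 exp(8 (2L)² (t' − s₂) + 2L √(2 H (t' − s₂)))`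
  have hM : 3 * Real.exp (8 * (2 * L) ^ 2 * (t' - (s + τ / 2)) +
      2 * L * Real.sqrt (2 * (Hm * (t' - (s + τ / 2))))) ≤
      3 * Real.exp (16 * L ^ 2 * τ + 2 * L * Real.sqrt (Hm * τ)) := by
    refine mul_le_mul_of_nonneg_left (Real.exp_le_exp.2 (add_le_add ?_ ?_)) (by norm_num)
    · have hL2 : 0 ≤ L ^ 2 := sq_nonneg L
      nlinarith
    · refine mul_le_mul_of_nonneg_left (Real.sqrt_le_sqrt ?_) (by positivity)
      nlinarith
  have hI : ∫ w, u (s + τ / 2) w ^ 2 ∂ν ≤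
      (Z * P) ^ 2 * Real.exp (2 * c - 2 * Nt) *
        (3 * Real.exp (16 * L ^ 2 * τ + 2 * L * Real.sqrt (Hm * τ))) := by
    calc ∫ w, u (s + τ / 2) w ^ 2 ∂ν
        ≤ ∫ w, (Z * P) ^ 2 * Real.exp (2 * c - 2 * Nt) * Real.exp (2 * L * d w) ∂ν :=
          integral_mono hint₁ hint₂ hpt
      _ = (Z * P) ^ 2 * Real.exp (2 * c - 2 * Nt) * ∫ w, Real.exp (2 * L * d w) ∂ν :=
          integral_const_mul _ _
      _ ≤ (Z * P) ^ 2 * Real.exp (2 * c - 2 * Nt) *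
            (3 * Real.exp (16 * L ^ 2 * τ + 2 * L * Real.sqrt (Hm * τ))) :=
          mul_le_mul_of_nonneg_left (hmom.trans hM) (by positivity)
  -- (4) divide by `t' − s₂ ≥ τ/4` and simplify the constant
  have hG0 : 0 ≤ (h t').gradSq (u t') x' := (h t').innerDual_self_nonneg (hR t') x' _
  have hB : τ / 4 * (h t').gradSq (u t') x' ≤ (Z * P) ^ 2 * Real.exp (2 * c - 2 * Nt) *
      (3 * Real.exp (16 * L ^ 2 * τ + 2 * L * Real.sqrt (Hm * τ))) := by
    have h1 : τ / 4 * (h t').gradSq (u t') x' ≤ (t' - (s + τ / 2)) * (h t').gradSq (u t') x' :=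
      mul_le_mul_of_nonneg_right hδ hG0
    nlinarith [key, hI, sq_nonneg (u t' x')]
  have hP2 : P ^ 2 = 2 ^ m * τ ^ (-(m : ℝ)) := by
    rw [hP, ← Real.rpow_natCast, ← Real.rpow_mul (by positivity : (0 : ℝ) ≤ τ / 2),
      show -(m : ℝ) / 2 * ((2 : ℕ) : ℝ) = -(m : ℝ) by push_cast; ring,
      Real.div_rpow hτ.le zero_le_two, Real.rpow_neg zero_le_two, Real.rpow_natCast,
      div_inv_eq_mul, mul_comm]
  have hτpow : τ ^ (-((m : ℝ) + 1)) = τ ^ (-(m : ℝ)) * τ⁻¹ := by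
    rw [neg_add, Real.rpow_add hτ, Real.rpow_neg_one]
  have hexp : Real.exp (2 * c - 2 * Nt) * Real.exp (16 * L ^ 2 * τ + 2 * L * Real.sqrt (Hm * τ))
      = Real.exp (2 * c + 16 * L ^ 2 * τ + 2 * L * Real.sqrt (Hm * τ)) * Real.exp (-2 * Nt) := by
    rw [← Real.exp_add, ← Real.exp_add]
    congr 1
    ring
  calc (h t').gradSq (u t') x'
      = 4 / τ * (τ / 4 * (h t').gradSq (u t') x') := by
        field_simp
    _ ≤ 4 / τ * ((Z * P) ^ 2 * Real.exp (2 * c - 2 * Nt) *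
          (3 * Real.exp (16 * L ^ 2 * τ + 2 * L * Real.sqrt (Hm * τ)))) :=
        mul_le_mul_of_nonneg_left hB (by positivity)
    _ = 4 / τ * Z ^ 2 * P ^ 2 * 3 * (Real.exp (2 * c - 2 * Nt) *
          Real.exp (16 * L ^ 2 * τ + 2 * L * Real.sqrt (Hm * τ))) := by ring
    _ = 2 ^ (m + 2) * 3 * Real.exp (2 * c + 16 * L ^ 2 * τ + 2 * L * Real.sqrt (Hm * τ)) *
          Z ^ 2 * τ ^ (-((m : ℝ) + 1)) * Real.exp (-2 * Nt) := by
        rw [hexp, hP2, hτpow, pow_add, div_eq_mul_inv]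
        ring

end BootstrapGradient

end Literature.Geometry.Riemannian
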